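import Summits.QuantumFields.BalabanUV.Beta.SymmetrisedStepJets
import Summits.QuantumFields.BalabanUV.Beta.SymAveragingHessianCounts
import Summits.QuantumFields.BalabanUV.Beta.MultiplierTableSlot
import Summits.QuantumFields.BalabanUV.Beta.SpineRecursiveParity

/-!
# `BalabanUV.Beta.SymTablesAn1FirstOrder` — binder row D1: **THE (0.4) LITERAL's TABLE RECORD AT an1's FIRST-ORDER SYM TABLES** — `SymTables d Lc` with
# `V := symVhSAt ρ_c d Lc`, `H := symHessFFAt ρ_c Lc`, `M j := M1Of d Lc H cΛ j` (an1's TABLES-SYM S2a, `SymAveragingHessianCounts`, LANDED p266815 ∕ p268105 ∕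
# p269197) and the two SECOND-ORDER tables `vh₂S`, `mixFF` + their letters DISPLAYED; the first-order letters (LV)(LH)(LM)(TV)(TH)(TM) are an1's theorems, and
# the ROW PARITIES (V-p)(H-p), (V-ff0) and (M-H) of the root of record (`RowD1JointEndSymWardTables`, p268146) are THEOREMS for this record
# (β sub-cell, BINDER-OWNERS row D1 OWNER `b2b-balaban-beta-an2`, gen 30; successor brick (N6a) of [AN2-G29-LANDED-FOLD], INTENT journal [AN2-G30-ONLINE])

HONEST FRAMING (cell charter, verbatim): «discharging BetaPertH makes Bałaban's UV stability UNCONDITIONAL — a real constructive-QFT result; it is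
NOT the continuum limit and NOT the Clay problem.»  HONEST DEPENDENCY: continuum YM on T⁴ ⇐ BetaPertH ∧ nine spine estimates (0/9 proved);
BetaPertH ⇐ (D1) ∧ (D4) ∧ CAP+tail; G-an2-4 gates asym, D1 and NE2/3/4.
NOT IN PRINT; OUR BOOKKEEPING.  [folklore] packaging + parity algebra over tree objects BY NAME: an1's `symVhSAt` ∕ `symHessFFAt` and their letters
(`symVhSAt_hV_ctr`, `symHessFFAt_hH_ctr`, `smul_symHessFFAt_hM_ctr`, `symVhSAt_hVt_ctr`, `symHessFFAt_hHt_ctr`, `symVhSAt_symm`, `symHessFFAt_antisymm`,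
`symVhSAt_hV0_ctr`), the slot `SpineRooted.M1Of` (`M1Of_translate`), leaf-05's parity calculus (`SpineRecursiveParity`: the proofs of `trK_vhSAt` ∕ `trK_hessFFAt`
transcribed token for token to the sym tables).  ONE data `def` (`symTablesAn1`, [our object] — a CANDIDATE record asserting nothing: it fixes three of the five
table slots of `SymmetrisedStepJets.SymTables` to an1's LANDED first-order sym tables and leaves the two second-order slots as ARGUMENTS).  No statement of
Bałaban's papers, no `[cite:]`, no `def … : Prop`; mints NO table VALUE (the second-order sym tables `vh₂S`, `mixFF` — an1's TABLES-SYM steps S2b+ — stay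
DISPLAYED with their (LB)(Lmix)(TB)(Tmix) letters); instantiates NO binder of the β-function wall.  NOT D1, NOT `BetaPertH`, NOT continuum, NOT Clay.

* §1 **`trK_symVhSAt`** (any root, any `d`, `L`): an1's symmetrised border table is ROW-PARITY-ODD (`trK = −sgnK`; fm∕mf support + `symVhSAt_symm`);
  **`trK_symHessFFAt`**: an1's symmetrised constraint Hessian is ROW-PARITY-ODD (ff support + `symHessFFAt_antisymm`); `trK_M1Of_symHessFFAt`.
* §2 **`symTablesAn1 d Lc cΛ vh₂S mixFF hB hmix hBt hmixt : SymTables d Lc`** and its field lemmas (`rfl`): `_V`, `_H`, `_M`, `_vh₂S`, `_mixFF`.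
* §3 the root's first-order letters for this record, as theorems: (V-p) `trK_symTablesAn1_V`, (H-p) `trK_symTablesAn1_H`, (V-ff0) `symTablesAn1_V_inl_inl`,
  (M-H) `symTablesAn1_M_eq_M1Of`.  ((S-V)⁰⁴ — `divV V u = conjV (mfNeg (linSym04At ρ_c Lc)) (diagK (legInd ρ_c u))` — is an1-g42's S2c-lite
  `SymAveragingWardRootedStencils.divV_symVhSAt_eq_conjV_ctr`, consumed by the root file `RowD1JointEndSymWardTablesAn1`, not restated here.)
Provenance: β sub-cell, unit beta-an2 gen 30, 2026-08-21 (v1); over the files named above BY NAME; no existing file touched.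
-/

noncomputable section

open Finset
open scoped BigOperators
open Literature.MathematicalPhysics.QuantumFieldTheory
open Literature.MathematicalPhysics.QuantumFieldTheory.Balaban1983to89
open Literature.MathematicalPhysics.QuantumFieldTheory.Balaban1983to89.Beta
open ExpKernelCalculus (MKer BiLoc VertexFamily shiftK)
open OneStepResolventKernel (Fib LocStencil)
open AffineAveraging (box toSite)
open AveragingContoursRooted (ctr ctrOff ctrOff_mem_box)
open BalabanCompositeJets (LocStencil₂)
open SecondOrderResponse (LocStencilFM)
open BalabanStepW2 (wM1)
open Summit.QuantumFields.BalabanUV.Beta.TameKernelCalculus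
open Summit.QuantumFields.BalabanUV.Beta.AxialDressingRooted (one_le_of_neZero)
open Summit.QuantumFields.BalabanUV.Beta.BorderedHessian (sgnF sgnF_inl sgnF_inr sgnK sgnK_apply)
open Summit.QuantumFields.BalabanUV.Beta.SpineRecursiveParity (parityOdd_smul)
open Summit.QuantumFields.BalabanUV.Beta.SpineRooted (M1Of M1Of_apply M1Of_translate)
open Summit.QuantumFields.BalabanUV.Beta.SymmetrisedStepJets (SymTables)
open Summit.QuantumFields.BalabanUV.Beta.SymAveragingHessianCounts (symVhSAt symHessFFAt symVhSAt_symm symHessFFAt_antisymm symHessFFAt_inl_inr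
  symHessFFAt_inr symVhSAt_hV_ctr symHessFFAt_hH_ctr symVhSAt_hVt_ctr symHessFFAt_hHt_ctr symVhSAt_hV0_ctr smul_symHessFFAt_hM_ctr)

namespace Summit.QuantumFields.BalabanUV.Beta.SymTablesAn1FirstOrder

variable {d : ℕ}

/-! ## §1 Row parities of an1's first-order symmetrised tables -/

section Parity

/-- [folklore] **an1's SYMMETRISED FIELD–MULTIPLIER BORDER TABLE IS ROW-PARITY-ODD** (any root `ρ`, any `d`, `L`): `symVhSAt ρ d L` lives on the fm∕mf blocks
(node 7a's packer) and is transposition-symmetric there (`symVhSAt_symm`), which is exactly `trK = −sgnK` on those blocks — leaf-05's `trK_vhSAt`, token for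
token, for the sym twin. -/
theorem trK_symVhSAt (ρ : Fin (d + 1) → ℤ) (L : ℕ) (κ : Fin (d + 1)) (u : Fin (d + 1) → ℤ) :
    trK (symVhSAt ρ d L rfl κ u) = -sgnK (symVhSAt ρ d L rfl κ u) := by
  funext x z a b
  simp only [trK_apply, Pi.neg_apply, sgnK_apply]
  rw [← symVhSAt_symm ρ L κ u x z a b]
  rcases a with α | μ <;> rcases b with β | ν
  · show (0 : ℝ) = -(sgnF (d := d) (Sum.inl α) * sgnF (d := d) (Sum.inl β) * 0)
    simp
  · simp only [sgnF_inl, sgnF_inr]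
    ring
  · simp only [sgnF_inl, sgnF_inr]
    ring
  · show (0 : ℝ) = -(sgnF (d := d) (Sum.inr μ) * sgnF (d := d) (Sum.inr ν) * 0)
    simp

/-- [folklore] **an1's SYMMETRISED W-HESSIAN TABLE OF THE CONSTRAINT IS ROW-PARITY-ODD** (any root): `symHessFFAt ρ L μ y` lives on the field–field block
and is antisymmetric there (`symHessFFAt_antisymm`) — leaf-05's `trK_hessFFAt` for the sym twin. -/
theorem trK_symHessFFAt (ρ : Fin (d + 1) → ℤ) (L : ℕ) (μ : Fin (d + 1)) (y : Fin (d + 1) → ℤ) :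
    trK (symHessFFAt ρ L μ y) = -sgnK (symHessFFAt ρ L μ y) := by
  funext x z a b
  simp only [trK_apply, Pi.neg_apply, sgnK_apply]
  rw [symHessFFAt_antisymm]
  rcases a with α | m <;> rcases b with β | n <;> simp

/-- [folklore] **THE MULTIPLIER TABLES OVER an1's SYM HESSIAN ARE ROW-PARITY-ODD**: `M1Of d Lc (symHessFFAt ρ Lc) cΛ j μ w = (cΛ·wM1 j) • symHessFFAt ρ Lc μ w`. -/
theorem trK_M1Of_symHessFFAt {Lc : ℕ} (ρ : Fin (d + 1) → ℤ) (cΛ : ℝ) (j : ℕ) (μ : Fin (d + 1)) (w : Fin (d + 1) → ℤ) :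
    trK (M1Of d Lc (symHessFFAt ρ Lc) cΛ j μ w) = -sgnK (M1Of d Lc (symHessFFAt ρ Lc) cΛ j μ w) := by
  rw [M1Of_apply]
  exact parityOdd_smul _ (trK_symHessFFAt ρ Lc μ w)

end Parity

/-! ## §2 The table record at an1's first-order sym tables (second-order tables displayed) -/

section Record

variable (d) (Lc : ℕ) [NeZero Lc]

/-- [our object] **THE (0.4) TABLE RECORD AT an1's FIRST-ORDER SYM TABLES** (centred root `ρ_c = ctr (d+1) Lc`): `V := symVhSAt ρ_c d Lc` (product chart),
`H := symHessFFAt ρ_c Lc`, `M j := M1Of d Lc H cΛ j` (weight `cΛ·wM1 j` — the (M-H) shape of the root of record, an1's value [AN1-G39-R7] Q-R41-1 (i));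
the SECOND-ORDER tables `vh₂S` (border) and `mixFF` (field–multiplier) with their letters (LB)(Lmix)(TB)(Tmix) are ARGUMENTS (an1's TABLES-SYM steps S2b+,
not typed at the time of writing).  The first-order letters are an1's theorems: (LV) `symVhSAt_hV_ctr`, (LH) `symHessFFAt_hH_ctr`, (LM)
`smul_symHessFFAt_hM_ctr` (weight `j ↦ cΛ·wM1 j`), (TV) `symVhSAt_hVt_ctr`, (TH) `symHessFFAt_hHt_ctr`, (TM) `M1Of_translate`.  A CANDIDATE record; asserts
nothing. -/
def symTablesAn1 (cΛ : ℝ)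
    (vh₂S : Fin (d + 1) → (Fin (d + 1) → ℤ) → Fin (d + 1) → (Fin (d + 1) → ℤ) → MKer (d + 1) (Fib d))
    (mixFF : Fin (d + 1) → (Fin (d + 1) → ℤ) → Fin (d + 1) → (Fin (d + 1) → ℤ) → MKer (d + 1) (Fib d))
    (hB : ∃ C δ : ℝ, 0 < δ ∧ LocStencil₂ vh₂S C δ) (hmix : ∃ C δ : ℝ, 0 < δ ∧ LocStencilFM Lc mixFF C δ)
    (hBt : ∀ (κ : Fin (d + 1)) (u : Fin (d + 1) → ℤ) (κ' : Fin (d + 1)) (u' t : Fin (d + 1) → ℤ),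
      vh₂S κ (u + (Lc : ℤ) • t) κ' (u' + (Lc : ℤ) • t) = shiftK (-((Lc : ℤ) • t)) (vh₂S κ u κ' u'))
    (hmixt : ∀ (κ : Fin (d + 1)) (u : Fin (d + 1) → ℤ) (μ : Fin (d + 1)) (w t : Fin (d + 1) → ℤ),
      mixFF κ (u + (Lc : ℤ) • t) μ (w + t) = shiftK (-((Lc : ℤ) • t)) (mixFF κ u μ w)) : SymTables d Lc where
  V := symVhSAt (ctr (d + 1) Lc) d Lc
  H := symHessFFAt (ctr (d + 1) Lc) Lc
  M := M1Of d Lc (symHessFFAt (ctr (d + 1) Lc) Lc) cΛ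
  vh₂S := vh₂S
  mixFF := mixFF
  hV := symVhSAt_hV_ctr (one_le_of_neZero Lc)
  hH := symHessFFAt_hH_ctr (one_le_of_neZero Lc)
  hM := smul_symHessFFAt_hM_ctr (one_le_of_neZero Lc) (fun j => cΛ * wM1 d Lc j)
  hB := hB
  hmix := hmix
  hVt := symVhSAt_hVt_ctr (one_le_of_neZero Lc)
  hHt := symHessFFAt_hHt_ctr Lc
  hMt := fun j μ w t => M1Of_translate (symHessFFAt_hHt_ctr Lc) cΛ j μ w t
  hBt := hBt
  hmixt := hmixt

variable {d Lc} (cΛ : ℝ)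
    (vh₂S : Fin (d + 1) → (Fin (d + 1) → ℤ) → Fin (d + 1) → (Fin (d + 1) → ℤ) → MKer (d + 1) (Fib d))
    (mixFF : Fin (d + 1) → (Fin (d + 1) → ℤ) → Fin (d + 1) → (Fin (d + 1) → ℤ) → MKer (d + 1) (Fib d))
    (hB : ∃ C δ : ℝ, 0 < δ ∧ LocStencil₂ vh₂S C δ) (hmix : ∃ C δ : ℝ, 0 < δ ∧ LocStencilFM Lc mixFF C δ)
    (hBt : ∀ (κ : Fin (d + 1)) (u : Fin (d + 1) → ℤ) (κ' : Fin (d + 1)) (u' t : Fin (d + 1) → ℤ),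
      vh₂S κ (u + (Lc : ℤ) • t) κ' (u' + (Lc : ℤ) • t) = shiftK (-((Lc : ℤ) • t)) (vh₂S κ u κ' u'))
    (hmixt : ∀ (κ : Fin (d + 1)) (u : Fin (d + 1) → ℤ) (μ : Fin (d + 1)) (w t : Fin (d + 1) → ℤ),
      mixFF κ (u + (Lc : ℤ) • t) μ (w + t) = shiftK (-((Lc : ℤ) • t)) (mixFF κ u μ w))

/-- [folklore] The record's border table is an1's `symVhSAt ρ_c d Lc` (`rfl`). -/
@[simp] theorem symTablesAn1_V : (symTablesAn1 d Lc cΛ vh₂S mixFF hB hmix hBt hmixt).V = symVhSAt (ctr (d + 1) Lc) d Lc := rfl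

/-- [folklore] The record's constraint Hessian is an1's `symHessFFAt ρ_c Lc` (`rfl`). -/
@[simp] theorem symTablesAn1_H : (symTablesAn1 d Lc cΛ vh₂S mixFF hB hmix hBt hmixt).H = symHessFFAt (ctr (d + 1) Lc) Lc := rfl

/-- [folklore] The record's multiplier tables are `M1Of d Lc (symHessFFAt ρ_c Lc) cΛ` (`rfl`). -/
@[simp] theorem symTablesAn1_M :
    (symTablesAn1 d Lc cΛ vh₂S mixFF hB hmix hBt hmixt).M = M1Of d Lc (symHessFFAt (ctr (d + 1) Lc) Lc) cΛ := rfl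

/-- [folklore] The record's second-order border table is the displayed `vh₂S` (`rfl`). -/
@[simp] theorem symTablesAn1_vh₂S : (symTablesAn1 d Lc cΛ vh₂S mixFF hB hmix hBt hmixt).vh₂S = vh₂S := rfl

/-- [folklore] The record's mixed table is the displayed `mixFF` (`rfl`). -/
@[simp] theorem symTablesAn1_mixFF : (symTablesAn1 d Lc cΛ vh₂S mixFF hB hmix hBt hmixt).mixFF = mixFF := rfl

end Record

/-! ## §3 The root's first-order letters for this record -/

section Letters

variable {Lc : ℕ} [NeZero Lc] (cΛ : ℝ)
    (vh₂S : Fin (d + 1) → (Fin (d + 1) → ℤ) → Fin (d + 1) → (Fin (d + 1) → ℤ) → MKer (d + 1) (Fib d))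
    (mixFF : Fin (d + 1) → (Fin (d + 1) → ℤ) → Fin (d + 1) → (Fin (d + 1) → ℤ) → MKer (d + 1) (Fib d))
    (hB : ∃ C δ : ℝ, 0 < δ ∧ LocStencil₂ vh₂S C δ) (hmix : ∃ C δ : ℝ, 0 < δ ∧ LocStencilFM Lc mixFF C δ)
    (hBt : ∀ (κ : Fin (d + 1)) (u : Fin (d + 1) → ℤ) (κ' : Fin (d + 1)) (u' t : Fin (d + 1) → ℤ),
      vh₂S κ (u + (Lc : ℤ) • t) κ' (u' + (Lc : ℤ) • t) = shiftK (-((Lc : ℤ) • t)) (vh₂S κ u κ' u'))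
    (hmixt : ∀ (κ : Fin (d + 1)) (u : Fin (d + 1) → ℤ) (μ : Fin (d + 1)) (w t : Fin (d + 1) → ℤ),
      mixFF κ (u + (Lc : ℤ) • t) μ (w + t) = shiftK (-((Lc : ℤ) • t)) (mixFF κ u μ w))

/-- [folklore] **(V-p) FOR THE RECORD** — the root's binder `hVp` VERBATIM: `∀ κ u, trK (tabs.V κ u) = −sgnK (tabs.V κ u)`. -/
theorem trK_symTablesAn1_V : ∀ (κ : Fin (d + 1)) (u : Fin (d + 1) → ℤ),
    trK ((symTablesAn1 d Lc cΛ vh₂S mixFF hB hmix hBt hmixt).V κ u) = -sgnK ((symTablesAn1 d Lc cΛ vh₂S mixFF hB hmix hBt hmixt).V κ u) :=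
  fun κ u => trK_symVhSAt (ctr (d + 1) Lc) Lc κ u

/-- [folklore] **(H-p) FOR THE RECORD** — the root's binder `hHp` VERBATIM: `∀ μ y, trK (tabs.H μ y) = −sgnK (tabs.H μ y)`. -/
theorem trK_symTablesAn1_H : ∀ (μ : Fin (d + 1)) (y : Fin (d + 1) → ℤ),
    trK ((symTablesAn1 d Lc cΛ vh₂S mixFF hB hmix hBt hmixt).H μ y) = -sgnK ((symTablesAn1 d Lc cΛ vh₂S mixFF hB hmix hBt hmixt).H μ y) :=
  fun μ y => trK_symHessFFAt (ctr (d + 1) Lc) Lc μ y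

/-- [folklore] **(V-ff0) FOR THE RECORD** — the root's binder `hV0` VERBATIM: the border table has no field–field block (an1's `symVhSAt_hV0_ctr`). -/
theorem symTablesAn1_V_inl_inl : ∀ (κ : Fin (d + 1)) (w x z : Fin (d + 1) → ℤ) (β β' : Fin (d + 1)),
    (symTablesAn1 d Lc cΛ vh₂S mixFF hB hmix hBt hmixt).V κ w x z (Sum.inl β) (Sum.inl β') = 0 :=
  symVhSAt_hV0_ctr Lc

/-- [folklore] **(M-H) FOR THE RECORD** — the root's binder `hM1` VERBATIM: `∀ j ρ w, tabs.M j ρ w = M1Of d Lc tabs.H cΛ j ρ w` (`rfl`). -/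
theorem symTablesAn1_M_eq_M1Of : ∀ (j : ℕ) (ρ : Fin (d + 1)) (w : Fin (d + 1) → ℤ),
    (symTablesAn1 d Lc cΛ vh₂S mixFF hB hmix hBt hmixt).M j ρ w =
      M1Of d Lc (symTablesAn1 d Lc cΛ vh₂S mixFF hB hmix hBt hmixt).H cΛ j ρ w :=
  fun _ _ _ => rfl

/-- [folklore] (M-p) for the record, every level: the multiplier tables are row-parity-odd (`trK_M1Of_symHessFFAt`). -/
theorem trK_symTablesAn1_M : ∀ (j : ℕ) (μ : Fin (d + 1)) (w : Fin (d + 1) → ℤ),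
    trK ((symTablesAn1 d Lc cΛ vh₂S mixFF hB hmix hBt hmixt).M j μ w) = -sgnK ((symTablesAn1 d Lc cΛ vh₂S mixFF hB hmix hBt hmixt).M j μ w) :=
  fun j μ w => trK_M1Of_symHessFFAt (ctr (d + 1) Lc) cΛ j μ w

end Letters

end Summit.QuantumFields.BalabanUV.Beta.SymTablesAn1FirstOrder

end
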